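import Summits.Parity.GeneralizedHardyLittlewood.Theorems.FordMaynardSieveConst01651SieveConst01651Dim5Check
import Summits.Parity.GeneralizedHardyLittlewood.Theorems.FordMaynardSieveConst01651SieveConst01651Witness
import HarnessLib

/-!
# Route `FordMaynardSieveConst01651`, target `SieveConst01651` (stmt-Parity-19185), stub `stub_coneCertClosed`,
# residue `h5`: the packed table agrees with the tree table (rows 12–23)

Def-free helper file.  `g2Fast` (21-bit digits of the 36 packed naturals `g2Rows` of `…Dim5Data`) coincides with
`g2Lookup` (`List.find?` in `certG2`) — row by row by kernel evaluation (`decide`, 168 tree lookups per row, ≈ 12 s of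
kernel time each), and identically `0` outside `a ≤ 35, b ≤ 83, j ≤ 1` by the table fact `certG2_fst_le`.  This links the
dimension-5 type checker to the witness `coneCert` (assembled as `g2Fast_eq_g2Lookup` in `…Dim5Final`).

References: [FordMaynard2024PrimeSieves] arXiv:2407.14368, §8.2.
-/

namespace Summit.Parity.GeneralizedHardyLittlewood.FordMaynardSieveConst01651SieveConst01651

/-- Row `12` of the packed table agrees with `certG2` (kernel evaluation). [folklore] -/
theorem g2Fast_row_12 : ∀ b, b ≤ 83 → ∀ j, j ≤ 1 → g2Fast 12 b j = g2Lookup 12 b j := by decide +kernel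

/-- Row `13` of the packed table agrees with `certG2` (kernel evaluation). [folklore] -/
theorem g2Fast_row_13 : ∀ b, b ≤ 83 → ∀ j, j ≤ 1 → g2Fast 13 b j = g2Lookup 13 b j := by decide +kernel

/-- Row `14` of the packed table agrees with `certG2` (kernel evaluation). [folklore] -/
theorem g2Fast_row_14 : ∀ b, b ≤ 83 → ∀ j, j ≤ 1 → g2Fast 14 b j = g2Lookup 14 b j := by decide +kernel

/-- Row `15` of the packed table agrees with `certG2` (kernel evaluation). [folklore] -/
theorem g2Fast_row_15 : ∀ b, b ≤ 83 → ∀ j, j ≤ 1 → g2Fast 15 b j = g2Lookup 15 b j := by decide +kernel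

/-- Row `16` of the packed table agrees with `certG2` (kernel evaluation). [folklore] -/
theorem g2Fast_row_16 : ∀ b, b ≤ 83 → ∀ j, j ≤ 1 → g2Fast 16 b j = g2Lookup 16 b j := by decide +kernel

/-- Row `17` of the packed table agrees with `certG2` (kernel evaluation). [folklore] -/
theorem g2Fast_row_17 : ∀ b, b ≤ 83 → ∀ j, j ≤ 1 → g2Fast 17 b j = g2Lookup 17 b j := by decide +kernel

/-- Row `18` of the packed table agrees with `certG2` (kernel evaluation). [folklore] -/
theorem g2Fast_row_18 : ∀ b, b ≤ 83 → ∀ j, j ≤ 1 → g2Fast 18 b j = g2Lookup 18 b j := by decide +kernel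

/-- Row `19` of the packed table agrees with `certG2` (kernel evaluation). [folklore] -/
theorem g2Fast_row_19 : ∀ b, b ≤ 83 → ∀ j, j ≤ 1 → g2Fast 19 b j = g2Lookup 19 b j := by decide +kernel

/-- Row `20` of the packed table agrees with `certG2` (kernel evaluation). [folklore] -/
theorem g2Fast_row_20 : ∀ b, b ≤ 83 → ∀ j, j ≤ 1 → g2Fast 20 b j = g2Lookup 20 b j := by decide +kernel

/-- Row `21` of the packed table agrees with `certG2` (kernel evaluation). [folklore] -/
theorem g2Fast_row_21 : ∀ b, b ≤ 83 → ∀ j, j ≤ 1 → g2Fast 21 b j = g2Lookup 21 b j := by decide +kernel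

/-- Row `22` of the packed table agrees with `certG2` (kernel evaluation). [folklore] -/
theorem g2Fast_row_22 : ∀ b, b ≤ 83 → ∀ j, j ≤ 1 → g2Fast 22 b j = g2Lookup 22 b j := by decide +kernel

/-- Row `23` of the packed table agrees with `certG2` (kernel evaluation). [folklore] -/
theorem g2Fast_row_23 : ∀ b, b ≤ 83 → ∀ j, j ≤ 1 → g2Fast 23 b j = g2Lookup 23 b j := by decide +kernel

end Summit.Parity.GeneralizedHardyLittlewood.FordMaynardSieveConst01651SieveConst01651
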